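import Summits.SmoothPoincare4.SmoothPoincare4.Theses.OneStabInvertible

/-!
# Birth skeleton (BC3) — crux `InvertibleStandard` (stmt-SmoothPoincare4-18065), route `OneStabInvertible`

`Cruxes/InvertibleStandard/Lines/birth.lean` · registrar planner-skel-stmt-SmoothPoincare4-18065-0 ·
2026-08-17 · mode skeleton-register (route re-audit bin HONEST). The crux is FIXED and is concluded
BY NAME:

  `Summit.SmoothPoincare4.SmoothPoincare4.Theses.OneStabInvertible.InvertibleStandard`

= SCH, "invertible homotopy 4-spheres are standard" (smooth 4-d Schoenflies ∧ Γ₄ = 0 in monoid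
form): for every smooth homotopy 4-sphere `M` (Statement binders, `e : M ≃ₕ S⁴`) and every smooth
`M'` (Hausdorff, second countable, `C^∞` on `𝓡 4`) such that `S⁴` is a connected sum `M # M'`
(relational `Literature.Topology.FourManifolds.IsConnectedSum (𝓡 4) (𝓡 4) (𝓡 4) M M' 𝕊⁴`), `M` is
diffeomorphic to `S⁴`.

## The cut — one puncture earlier than SchoenfliesSplit

The route header (TWO-LAYER PLAN) names the split: InvertibleStandard ⇐ PuncturedEmbedsOfInvertible
(`S⁴ = M # M'` ⇒ a punctured `M ∖ {p}` embeds in `ℝ⁴`, classical) → StandardOfPuncturedEmbeds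
(= SchoenfliesSplit's shell capping (B♯) + a POINTWISE cap bridge over the bare `M`). Typed here as
three named statements and a PROVED composition:

* `stub_puncturedEmbeds_of_connectedSumSphere` — KNOWN (M): the gluing embedding `jA` of the
  connected sum is never onto `S⁴`, and `S⁴ ∖ {q} ≅ ℝ⁴`.
* `stub_shellCap` — OPEN (the heart): token-identical with SchoenfliesSplit's crux
  `SchsplitShellCap` (stmt-SmoothPoincare4-11868), whose own registered skeleton
  (Schoenflies leaf → ball transport → Cerf) is the next layer down.
* `stub_capBridge_pointwise` — KNOWN (L, provable now): shell capping ⇒ (`M` homotopy 4-sphere,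
  `f : M ∖ {p} ↪ ℝ⁴` smooth) ⇒ `M ≅ S⁴`; SchoenfliesSplit's `SchsplitCapBridge` (stmt-11912) one
  sphere at a time.
* `InvertibleStandard_of : Sig.stub₁ → Sig.stub₂ → Sig.stub₃ → InvertibleStandard` — 3 tactic lines,
  no `sorry`; `invertibleStandard_of_stubs : InvertibleStandard` closes the crux modulo the stubs.

No new objects are posited; no definition is requested (Mathlib `TopologicalSpace.Opens`
submanifold structure, `Manifold.IsSmoothEmbedding`, `Diffeomorph`, `ContinuousMap.HomotopyEquiv`
and the Literature `IsConnectedSum` suffice).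

## Checks run by the registrar (folder `bc/`, 2026-08-17)

* `lean check --json` on this file: rc 0, errors [], sorries 3 = the three `stub_*` (no `sorry`
  in `InvertibleStandard_of`), axioms of `InvertibleStandard_of` ⊆ {propext, Classical.choice,
  Quot.sound}.
* BC3 probes (`bc/probe_stub{1,2,3}_{crux,summit}.lean`, battery
  `first | exact? | simpa [Stub] | (unfold Stub; simpa) | aesop`, `maxHeartbeats 400000`): all six
  `stubᵢ → InvertibleStandard` / `stubᵢ → SmoothPoincare4` FAIL (rc 1, unsolved goal, aesop
  exhaustive search failed) — no stub is cheaply the crux or the summit.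
* Informational converse: `SmoothPoincare4 → stub₃` holds trivially on paper (as for the crux
  itself: the refuter's `spc4_implies_crux`), so stub 3 and the crux are SPC4-shielded; stub 1 has
  no homotopy-sphere hypothesis and stub 2 is Schoenflies-strength.

## Disproof used

None on file: `ledger crux ls stmt-SmoothPoincare4-18065` showed no `Disproof.lean` at
registration. The refuter's crux-attack at birth (2026-08-17, SURVIVES) proved `S → C`
(`spc4_implies_crux`, so `¬C` = an exotic `S⁴`), `hyps_witness` (`M = M' = S⁴` via
`isConnectedSum_sphere_self_holds`) and `dropped_hcs_is_summit`; this stub set honours the last: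
`hcs` is consumed (stub 1), not dropped.

Sources: FreedmanGompfMorrisonWalker2010 (doi:10.4171/qt/5) p.3 fn.; KervaireMilnorAnnals1963 §2;
Mazur1959; Scharlemann1984; Gompf1991Killing; CerfDiffeoSphere1968; HirschDT1976 Ch. 8 Thm 2.1;
Kirby1989 Ch. I §6; Kirby1997 Problem 4.32; BudneyGabai2019 (arXiv:1912.09029).
-/

open scoped Manifold ContDiff Topology
open ContinuousMap

noncomputable section

namespace Summit.SmoothPoincare4.SmoothPoincare4.Cruxes.InvertibleStandard.Birth

open Summit.SmoothPoincare4.SmoothPoincare4.Theses.OneStabInvertible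

/-! ## §1 The stub SIGNATURES (`Sig.stub_<name> : Prop`; the skeleton audit reads the hypotheses of
`InvertibleStandard_of` BY NAME, heads = stub names) -/

/-- **STUB 1 — PUNCTURED EMBEDDING OF A UNIT** (`PuncturedEmbedsOfInvertible` of the route's
two-layer plan; KNOWN mathematics, formal size M). If `S⁴` is a connected sum `M # M'`
(relational `IsConnectedSum`, Kervaire–Milnor discs `i₁ : ℝ⁴ → M`, `i₂ : ℝ⁴ → M'`, gluing
embeddings `jA`, `jB`), then the punctured manifold `M ∖ {p}` (for `p := i₁ 0`, with Mathlib's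
open-submanifold structure — definitionally the piece `puncture i₁`) smoothly embeds in `ℝ⁴`.
Proof on paper: `jA : M ∖ {i₁ 0} ↪ S⁴` is an open smooth embedding which is NEVER onto — a point
`jB (i₂ v)` with `‖v‖ ≥ 1` is related to no point of `M` (`connectedSumRel` only identifies
`i₂ ((1 - t) • u)`, `0 < t < 1`, and `i₂` is injective on all of `ℝ⁴`) — so `jA` lands in
`S⁴ ∖ {q} ≅ ℝ⁴` (stereographic chart `chartAt _ (-q)` of Mathlib's sphere, a diffeomorphism onto
`ℝ⁴`); compose (composition of smooth embeddings is still `proof_wanted` in Mathlib: part of the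
size). No homotopy-equivalence hypothesis is needed and none is taken; no compactness of `M'` is
used. Why it might fail: only as typed (Opens-subtype plumbing). Sources: KervaireMilnorAnnals1963
§2; Kosinski1993 VI.1; doi:10.4171/qt/5 p.3 fn. ("invertible" ⇔ punctured embedding). -/
def Sig.stub_puncturedEmbeds_of_connectedSumSphere : Prop :=
    ∀ (M : Type) [TopologicalSpace M] [T2Space M] [SecondCountableTopology M] [ChartedSpace (EuclideanSpace ℝ (Fin 4)) M] [IsManifold (𝓡 4) ∞ M]
      (M' : Type) [TopologicalSpace M'] [T2Space M'] [SecondCountableTopology M'] [ChartedSpace (EuclideanSpace ℝ (Fin 4)) M'] [IsManifold (𝓡 4) ∞ M'],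
      Literature.Topology.FourManifolds.IsConnectedSum (𝓡 4) (𝓡 4) (𝓡 4) M M' (Metric.sphere (0 : EuclideanSpace ℝ (Fin 5)) 1) →
        ∃ (p : M) (f : (⟨{p}ᶜ, isOpen_compl_singleton⟩ : TopologicalSpace.Opens M) → EuclideanSpace ℝ (Fin 4)),
          Manifold.IsSmoothEmbedding (𝓡 4) (𝓡 4) ∞ f

/-- **STUB 2 — SHELL CAPPING (B♯) = smooth 4-d Schoenflies (ball form in `ℝ⁴`) ∧ Cerf `Γ₄ = 0`**
(OPEN — the heart; load-bearing stub). TOKEN-IDENTICAL with the body of route SchoenfliesSplit's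
crux `Summit.SmoothPoincare4.SmoothPoincare4.Theses.SchoenfliesSplit.SchsplitShellCap`
(stmt-SmoothPoincare4-11868; checked `Iff.rfl` against that decl in the registrar's folder,
`bc/verbatim_check.lean`, rc 0), so a proof of that item closes this stub by `exact`, and that
crux's own registered skeleton (`Cruxes/SchsplitShellCap/Lines/birth.lean`: Schoenflies leaf →
ball transport → Cerf) is this stub's next layer. Statement: a `C^∞` embedding `f` of a two-sided
spherical shell `A_ε = {1 - ε < ‖x‖ < 1 + ε} ⊆ ℝ⁴` into `ℝ⁴` (open image, `C^∞` left inverse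
`finv`), with two-sidedness data `ℝ⁴ ∖ f(S³) = P ⊔ Q` (open, `P` bounded, inner half-shell into
`P`, outer into `Q`), agrees on a thinner shell `A_δ` with a `C^∞` embedding `F` of the ball
`B(0, 1 + δ)`. Why it might fail: an exotic Schoenflies ball (a smooth `S³ ⊂ S⁴` bounding no
smooth ball — an invertible exotic 4-sphere) refutes it; known only for genus ≤ 2 / 3-handle-free
balls. Sources: Mazur1959, Scharlemann1984, Gompf1991Killing, CerfDiffeoSphere1968, Kirby1997
Problem 4.32, arXiv:1912.09029. Size: open problem. -/
def Sig.stub_shellCap : Prop :=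
    ∀ (f finv : EuclideanSpace ℝ (Fin 4) → EuclideanSpace ℝ (Fin 4)) (ε : ℝ), 0 < ε → ContDiffOn ℝ ∞ f {x | 1 - ε < ‖x‖ ∧ ‖x‖ < 1 + ε} → IsOpen (f '' {x | 1 - ε < ‖x‖ ∧ ‖x‖ < 1 + ε}) → ContDiffOn ℝ ∞ finv (f '' {x | 1 - ε < ‖x‖ ∧ ‖x‖ < 1 + ε}) → (∀ x : EuclideanSpace ℝ (Fin 4), 1 - ε < ‖x‖ → ‖x‖ < 1 + ε → finv (f x) = x) → (∃ P Q : Set (EuclideanSpace ℝ (Fin 4)), IsOpen P ∧ IsOpen Q ∧ Disjoint P Q ∧ P ∪ Q = (f '' Metric.sphere 0 1)ᶜ ∧ Bornology.IsBounded P ∧ (∀ x : EuclideanSpace ℝ (Fin 4), 1 - ε < ‖x‖ → ‖x‖ < 1 → f x ∈ P) ∧ ∀ x : EuclideanSpace ℝ (Fin 4), 1 < ‖x‖ → ‖x‖ < 1 + ε → f x ∈ Q) → ∃ (F Finv : EuclideanSpace ℝ (Fin 4) → EuclideanSpace ℝ (Fin 4)) (δ : ℝ), 0 < δ ∧ δ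 ≤ ε ∧ ContDiffOn ℝ ∞ F (Metric.ball 0 (1 + δ)) ∧ (∀ x : EuclideanSpace ℝ (Fin 4), 1 - δ < ‖x‖ → ‖x‖ < 1 + δ → F x = f x) ∧ IsOpen (F '' Metric.ball 0 (1 + δ)) ∧ ContDiffOn ℝ ∞ Finv (F '' Metric.ball 0 (1 + δ)) ∧ ∀ x ∈ Metric.ball (0 : EuclideanSpace ℝ (Fin 4)) (1 + δ), Finv (F x) = x

/-- **STUB 3 — POINTWISE CAP BRIDGE** (KNOWN, elementary mathematics; formal size L; provable
now). Shell capping ⇒ for every smooth homotopy 4-sphere `M` (Statement binders, `e : M ≃ₕ S⁴`),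
every `p : M` and every smooth embedding `f : M ∖ {p} ↪ ℝ⁴`, `M ≅ S⁴`. It is route
SchoenfliesSplit's item `SchsplitCapBridge` (stmt-SmoothPoincare4-11912, registered skeleton
`Cruxes/SchsplitCapBridge/Lines/birth.lean`: two-sided shell → cap fills inside → cap gluing →
chart transfer) with the punctured-embedding hypothesis moved under the `∀ M` (ONE sphere at a
time) and stated over the bare binders (`M` is compact by the proved tree theorem
`compactSpace_of_homotopyEquiv_sphere_four_holds`, connected as a homotopy 4-sphere). Proof on
paper: affine chart `ψ` at `p`, shell map `g = f ∘ ψ ∘ ι` (`ι` the inversion), two-sidedness data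
`P = f(K̊)`, `Q = ℝ⁴ ∖ f(K)` with `K = M ∖ ψ(B̊(0,1))` compact; cap `F` from stub 2;
`Θ := F⁻¹ ∘ f ∪ ι ∘ ψ⁻¹ : M ∖ {p} ≃ₘ ℝ⁴` agrees with the inverted chart near `p`, whence `M ≅ S⁴` by
the PROVED `Literature.Geometry.Symplectic.nonempty_diffeomorph_sphere_of_agreesWithInvertedChartNear`
(double of discs). Why it might fail: only as typed (Opens-subtype embedding, the `P/Q` data fed
to stub 2). Sources: HirschDT1976 Ch. 8 Thm 2.1, Palais1960, Kirby1989 Ch. I §6. -/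
def Sig.stub_capBridge_pointwise : Prop :=
    Sig.stub_shellCap →
      ∀ (M : Type) [TopologicalSpace M] [T2Space M] [SecondCountableTopology M] [ChartedSpace (EuclideanSpace ℝ (Fin 4)) M] [IsManifold (𝓡 4) ∞ M],
        ContinuousMap.HomotopyEquiv M (Metric.sphere (0 : EuclideanSpace ℝ (Fin 5)) 1) →
        ∀ (p : M) (f : (⟨{p}ᶜ, isOpen_compl_singleton⟩ : TopologicalSpace.Opens M) → EuclideanSpace ℝ (Fin 4)),
          Manifold.IsSmoothEmbedding (𝓡 4) (𝓡 4) ∞ f →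
            Nonempty (M ≃ₘ⟮𝓡 4, 𝓡 4⟯ Metric.sphere (0 : EuclideanSpace ℝ (Fin 5)) 1)

/-! ## §2 The registered stubs (the ONLY `sorry`s of this file). Each is stated with its FULL
signature text (that text is what `ledger skeleton check` registers, so provers read real
mathematics over Mathlib / Literature names only); `invertibleStandard_of_stubs` below is the
kernel check that each registered text is (syntactically, hence definitionally) its `Sig.stub_*`. -/

/-- Registered stub 1 (known, M): a unit of the Kervaire–Milnor monoid has a punctured copy
smoothly embedded in `ℝ⁴`. Text = `Sig.stub_puncturedEmbeds_of_connectedSumSphere`. -/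
theorem stub_puncturedEmbeds_of_connectedSumSphere :
    ∀ (M : Type) [TopologicalSpace M] [T2Space M] [SecondCountableTopology M] [ChartedSpace (EuclideanSpace ℝ (Fin 4)) M] [IsManifold (𝓡 4) ∞ M]
      (M' : Type) [TopologicalSpace M'] [T2Space M'] [SecondCountableTopology M'] [ChartedSpace (EuclideanSpace ℝ (Fin 4)) M'] [IsManifold (𝓡 4) ∞ M'],
      Literature.Topology.FourManifolds.IsConnectedSum (𝓡 4) (𝓡 4) (𝓡 4) M M' (Metric.sphere (0 : EuclideanSpace ℝ (Fin 5)) 1) →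
        ∃ (p : M) (f : (⟨{p}ᶜ, isOpen_compl_singleton⟩ : TopologicalSpace.Opens M) → EuclideanSpace ℝ (Fin 4)),
          Manifold.IsSmoothEmbedding (𝓡 4) (𝓡 4) ∞ f := by
  sorry

/-- Registered stub 2 (OPEN, hardest): shell capping (B♯), token-identical with
`SchoenfliesSplit.SchsplitShellCap` (stmt-SmoothPoincare4-11868). Text = `Sig.stub_shellCap`. -/
theorem stub_shellCap :
    ∀ (f finv : EuclideanSpace ℝ (Fin 4) → EuclideanSpace ℝ (Fin 4)) (ε : ℝ), 0 < ε → ContDiffOn ℝ ∞ f {x | 1 - ε < ‖x‖ ∧ ‖x‖ < 1 + ε} → IsOpen (f '' {x | 1 - ε < ‖x‖ ∧ ‖x‖ < 1 + ε}) → ContDiffOn ℝ ∞ finv (f '' {x | 1 - ε < ‖x‖ ∧ ‖x‖ < 1 + ε}) → (∀ x : EuclideanSpace ℝ (Fin 4), 1 - ε < ‖x‖ → ‖x‖ < 1 + ε → finv (f x) = x) → (∃ P Q : Set (EuclideanSpace ℝ (Fin 4)), IsOpen P ∧ IsOpen Q ∧ Disjoint P Q ∧ P ∪ Q = (f '' Metric.sphere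 0 1)ᶜ ∧ Bornology.IsBounded P ∧ (∀ x : EuclideanSpace ℝ (Fin 4), 1 - ε < ‖x‖ → ‖x‖ < 1 → f x ∈ P) ∧ ∀ x : EuclideanSpace ℝ (Fin 4), 1 < ‖x‖ → ‖x‖ < 1 + ε → f x ∈ Q) → ∃ (F Finv : EuclideanSpace ℝ (Fin 4) → EuclideanSpace ℝ (Fin 4)) (δ : ℝ), 0 < δ ∧ δ ≤ ε ∧ ContDiffOn ℝ ∞ F (Metric.ball 0 (1 + δ)) ∧ (∀ x : EuclideanSpace ℝ (Fin 4), 1 - δ < ‖x‖ → ‖x‖ < 1 + δ → F x = f x) ∧ IsOpen (F '' Metric.ball 0 (1 + δ)) ∧ ContDiffOn ℝ ∞ Finv (F '' Metric.ball 0 (1 + δ)) ∧ ∀ x ∈ Metric.ball (0 : EuclideanSpace ℝ (Fin 4)) (1 + δ), Finv (F x) = x := by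
  sorry

/-- Registered stub 3 (known, L): the pointwise cap bridge — shell capping (hypothesis, verbatim the
text of stub 2) ⇒ every homotopy 4-sphere with a punctured copy smoothly embedded in `ℝ⁴` is
diffeomorphic to `S⁴`. Text = `Sig.stub_capBridge_pointwise` with `Sig.stub_shellCap` unfolded. -/
theorem stub_capBridge_pointwise :
    (∀ (f finv : EuclideanSpace ℝ (Fin 4) → EuclideanSpace ℝ (Fin 4)) (ε : ℝ), 0 < ε → ContDiffOn ℝ ∞ f {x | 1 - ε < ‖x‖ ∧ ‖x‖ < 1 + ε} → IsOpen (f '' {x | 1 - ε < ‖x‖ ∧ ‖x‖ < 1 + ε}) → ContDiffOn ℝ ∞ finv (f '' {x | 1 - ε < ‖x‖ ∧ ‖x‖ < 1 + ε}) → (∀ x : EuclideanSpace ℝ (Fin 4), 1 - ε < ‖x‖ → ‖x‖ < 1 + ε → finv (f x) = x) → (∃ P Q : Set (EuclideanSpace ℝ (Fin 4)), IsOpen P ∧ IsOpen Q ∧ Disjoint P Q ∧ P ∪ Q = (f '' Metric.sphere 0 1)ᶜ ∧ Bornology.IsBounded P ∧ (∀ x : EuclideanSpace ℝ (Fin 4),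 1 - ε < ‖x‖ → ‖x‖ < 1 → f x ∈ P) ∧ ∀ x : EuclideanSpace ℝ (Fin 4), 1 < ‖x‖ → ‖x‖ < 1 + ε → f x ∈ Q) → ∃ (F Finv : EuclideanSpace ℝ (Fin 4) → EuclideanSpace ℝ (Fin 4)) (δ : ℝ), 0 < δ ∧ δ ≤ ε ∧ ContDiffOn ℝ ∞ F (Metric.ball 0 (1 + δ)) ∧ (∀ x : EuclideanSpace ℝ (Fin 4), 1 - δ < ‖x‖ → ‖x‖ < 1 + δ → F x = f x) ∧ IsOpen (F '' Metric.ball 0 (1 + δ)) ∧ ContDiffOn ℝ ∞ Finv (F '' Metric.ball 0 (1 + δ)) ∧ ∀ x ∈ Metric.ball (0 : EuclideanSpace ℝ (Fin 4)) (1 + δ), Finv (F x) = x) →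
      ∀ (M : Type) [TopologicalSpace M] [T2Space M] [SecondCountableTopology M] [ChartedSpace (EuclideanSpace ℝ (Fin 4)) M] [IsManifold (𝓡 4) ∞ M],
        ContinuousMap.HomotopyEquiv M (Metric.sphere (0 : EuclideanSpace ℝ (Fin 5)) 1) →
        ∀ (p : M) (f : (⟨{p}ᶜ, isOpen_compl_singleton⟩ : TopologicalSpace.Opens M) → EuclideanSpace ℝ (Fin 4)),
          Manifold.IsSmoothEmbedding (𝓡 4) (𝓡 4) ∞ f →
            Nonempty (M ≃ₘ⟮𝓡 4, 𝓡 4⟯ Metric.sphere (0 : EuclideanSpace ℝ (Fin 5)) 1) := by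
  sorry

/-! ## §3 The composition — the crux BY NAME from the three stubs (real proof, no `sorry`) -/

/-- **Skeleton theorem.** Punctured embedding of a unit + shell capping + pointwise cap bridge
imply the crux `Theses.OneStabInvertible.InvertibleStandard` BY NAME: given `M`, `e`, `M'` and
`hcs : IsConnectedSum … M M' S⁴`, stub 1 yields `p` and `f : M ∖ {p} ↪ ℝ⁴`, and stub 3 (fed with
stub 2) returns the diffeomorphism `M ≃ₘ S⁴`. The connected-sum hypothesis is consumed by stub 1
and the homotopy equivalence by stub 3 (cf. the refuter's `dropped_hcs_is_summit`: without `hcs`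
the statement is the summit). -/
theorem InvertibleStandard_of :
    Sig.stub_puncturedEmbeds_of_connectedSumSphere → Sig.stub_shellCap →
      Sig.stub_capBridge_pointwise → InvertibleStandard := by
  intro h₁ h₂ h₃ M _ _ _ _ _ e M' _ _ _ _ _ hcs
  obtain ⟨p, f, hf⟩ := h₁ M M' hcs
  exact h₃ h₂ M e p f hf

/-- The crux by name, closed modulo the three registered stubs (its axiom closure contains
`sorryAx` through the stubs only; `InvertibleStandard_of` itself is sorry-free). -/
theorem invertibleStandard_of_stubs : InvertibleStandard :=
  InvertibleStandard_of stub_puncturedEmbeds_of_connectedSumSphere stub_shellCap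
    stub_capBridge_pointwise

end Summit.SmoothPoincare4.SmoothPoincare4.Cruxes.InvertibleStandard.Birth

end
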